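import Literature.AlgebraicGeometry.Pohlmann1968.NondegenerateCMAlgebraTypes
import Literature.NumberTheory.ComplexMultiplication.CMTypeRankFamilies
import HarnessLib

/-!
# Families of CM types on two-element slots: the sign characters `χ_i` of imaginary quadratic slots and the nondegeneracy
# (`rank = |I| + 1`) of a Kubota-separating family of CM elliptic curves (Imai; Moonen–Zarhin 1999 Cor. (3.9))

For a family `(Φ_i)_{i ∈ I}` of CM types of imaginary quadratic fields `K_i` (two-element slots `E_i = Hom(K_i, ℂ) = {s, s̄}`):
every `g ∈ Aut(ℂ)` acts on `E_i` trivially or as complex conjugation (`forall_smul_eq_or_forall_smul_eq_rho_smul`), which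
defines the SIGN CHARACTER `slotSign Φ i : Aut(ℂ) → ℚ`, `χ_i(g) = ±1` (definition with body, two API lemmas), and the
`±1`-vector of a translate of the family type is the `χ`-weighted sum `u_g(Σ) = Σ_i χ_i(g) · ext_i(u_1(Φ_i))`
(`weightLift`, definition with body). Kubota separation of `Σ` makes the `χ_i` pairwise distinct
(`slotSign_injective_of_separating`), distinct characters are linearly independent (Dedekind–Artin), hence
`|I| ≤ dim U(Σ)` and `rank(Σ) = |⊔_i E_i|/2 + 1`: **a separating family of CM types of imaginary quadratic fields is
nondegenerate** (`isNondegenerateFamily_of_finrank_eq_two` — `Hg(∏ E_i) = ∏ Hg(E_i)` for pairwise non-isogenous CM elliptic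
curves, Imai's theorem / Moonen–Zarhin 1999 Cor. (3.9), in Deligne's rank form).

* Part 1 — from `CorCM/QuadraticCMFamiliesHodge` (24/28 declarations; namespace
  `Literature.AlgebraicGeometry.ComplexMultiplication`): Products of CM elliptic curves through Deligne's rank: a
  SEPARATING family of CM types of imaginary quadratic. Declarations: `antiVec_eq_of_forall_smul_eq`,
  `antiVec_eq_neg_of_forall_smul_eq_rho_smul`, `antiVec_one_mul_self`, `weightLift` (def), `weightLift_apply`,
  `weightLift_single`, `eq_or_eq_rho_smul`, `nonempty_of_card_eq_two`, `exists_mem`,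
  `forall_smul_eq_or_forall_smul_eq_rho_smul`, `slotSign` (def), `slotSign_apply`, `slotSign_of_forall_smul_eq`,
  `slotSign_of_forall_smul_eq_rho_smul`, `forall_smul_eq_iff_slotSign_eq_one`, `antiVec_eq_slotSign_mul`,
  `antiVec_sigmaType_eq_weightLift`, `slotSign_injective_of_separating`, `linearIndependent_slotSign`,
  `slotExt_antiVec_one_mem_antiSpan`, `card_le_finrank_antiSpan_sigmaType`,
  `typeRank_sigmaType_eq_of_slotSign_injective`, `typeRank_sigmaType_eq_of_separating`,
  `isNondegenerateFamily_of_finrank_eq_two`.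

## References

* [MoonenZarhin1999LowDim] Cor. (3.9) (Imai).
* [Deligne1982HodgeCycles] I Ex. 3.7 (pp. 25–26).
* [Gordon1999HodgeAVSurvey] §3 Theorem, 7.5, 10.10.
* [Kubota1965] §2 (p. 115).
* [Shimura1998] §5.2.

Provenance: Literature home of the used declarations of the Summits-side modules listed part by part above (cells
`pub-hodge-ring2` / `pub-hodgecm2`; namespaces `Summit.HodgeConjecture.CorCM` re-rooted under
`Literature.AlgebraicGeometry.…` as stated), whose imports are `Literature/` and Mathlib only for the declarations
used; re-homed verbatim (proofs unchanged) so that Literature users are served without importing `Summits/`. Lane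
`lit-hodgefound`, seat p20 (generation 34). 2 definition(s) with bodies and 22 theorems; no named fact, no `sorry`;
axioms `propext`, `Classical.choice`, `Quot.sound`.
-/

/-! ## Part 1: QuadraticCMFamiliesHodge -/

set_option autoImplicit false

noncomputable section

open _root_.CategoryTheory _root_.CategoryTheory.Limits NumberField
open scoped BigOperators

namespace Literature.AlgebraicGeometry.ComplexMultiplication

open Literature.NumberTheory.ComplexMultiplication
open Literature.AlgebraicGeometry.Motives (AbelianVariety CMType)
open Literature.AlgebraicGeometry.HodgeTheory
open Literature.AlgebraicGeometry.Pohlmann1968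

/-! ### Two-element slots: every `g` fixes a slot or acts on it as `ρ`; the sign characters -/

namespace TwoSlot

variable {G : Type*} [Group G] {I : Type*} {E : I → Type*} [∀ i, MulAction G (E i)] {ρ : G} {Φ : ∀ i, Set (E i)}

/-- On a fixed slot the `±1`-vector of the translate is that of `Φ_i` itself. [cite: MoonenZarhin1999LowDim, Cor. (3.9)] -/
theorem antiVec_eq_of_forall_smul_eq {i : I} {g : G} (hg : ∀ s : E i, g • s = s) (s : E i) :
    antiVec (Φ i) g s = antiVec (Φ i) (1 : G) s := by
  have h1 : translateInd (Φ i) g s = translateInd (Φ i) (1 : G) s := by unfold translateInd; rw [hg s, one_smul]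
  simp only [antiVec, h1]

/-- On a slot where `g` acts as `ρ` the `±1`-vector of the translate is MINUS that of `Φ_i`. [cite: MoonenZarhin1999LowDim, Cor. (3.9)] -/
theorem antiVec_eq_neg_of_forall_smul_eq_rho_smul {i : I} (h : IsCMTypeWith ρ (Φ i)) {g : G}
    (hg : ∀ s : E i, g • s = ρ • s) (s : E i) : antiVec (Φ i) g s = -antiVec (Φ i) (1 : G) s := by
  have h1 : translateInd (Φ i) g s = translateInd (Φ i) (1 : G) (ρ • s) := by unfold translateInd; rw [hg s, one_smul]
  simp only [antiVec, h1, h.translateInd_rho_smul]; ring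

/-- `u_1(Φ_i)(s)² = 1`. [cite: MoonenZarhin1999LowDim, Cor. (3.9)] -/
private theorem antiVec_one_mul_self (i : I) (s : E i) :
    antiVec (Φ i) (1 : G) s * antiVec (Φ i) (1 : G) s = 1 := by
  by_cases hs : (1 : G) • s ∈ Φ i
  · simp only [antiVec, translateInd_of_mem hs]; norm_num
  · simp only [antiVec, translateInd_of_not_mem hs]; norm_num

variable (G) in
/-- `a ↦ Σ_i a_i · ext_i(u_1(Φ_i))`: the weights assembled from multiples of the members' `±1`-vectors.
[cite: Gordon1999HodgeAVSurvey, §3 Theorem (proof)] -/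
def weightLift (Φ : ∀ i, Set (E i)) : (I → ℚ) →ₗ[ℚ] ((Σ i, E i) → ℚ) where
  toFun a := sigmaLift fun j => a j • antiVec (Φ j) (1 : G)
  map_add' a b := by funext x; simp only [sigmaLift_apply, Pi.add_apply, Pi.smul_apply, smul_eq_mul]; ring
  map_smul' c a := by funext x; simp only [sigmaLift_apply, Pi.smul_apply, smul_eq_mul, RingHom.id_apply]; ring

/-- Unfolding of `weightLift`. [cite: MoonenZarhin1999LowDim, Cor. (3.9)] -/
theorem weightLift_apply (a : I → ℚ) (x : Σ i, E i) :
    weightLift G Φ a x = a x.1 * antiVec (Φ x.1) (1 : G) x.2 := by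
  change sigmaLift (fun j => a j • antiVec (Φ j) (1 : G)) x = _
  rw [sigmaLift_apply, Pi.smul_apply, smul_eq_mul]

/-- The weight lift of the `i`-th coordinate vector is `ext_i(u_1(Φ_i))`. [cite: MoonenZarhin1999LowDim, Cor. (3.9)] -/
theorem weightLift_single [DecidableEq I] (i : I) :
    weightLift G Φ (fun k => if i = k then 1 else 0) = slotExt i (antiVec (Φ i) (1 : G)) := by
  funext x
  obtain ⟨j, s⟩ := x
  rw [weightLift_apply]
  by_cases hij : i = j
  · subst hij; rw [if_pos rfl, one_mul, slotExt_apply_same]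
  · rw [if_neg hij, zero_mul, slotExt_apply_of_ne (fun hji => hij hji.symm)]

variable [∀ i, Fintype (E i)]

/-- In a two-element slot carrying a CM type for `ρ`, every element is `s` or `ρ s` (`Hom(K, ℂ) = {s, s̄}` for an
imaginary quadratic field). [cite: Kubota1965, §2 (p. 115)] -/
theorem eq_or_eq_rho_smul {i : I} (h : IsCMTypeWith ρ (Φ i)) (hc : Fintype.card (E i) = 2) (s t : E i) :
    t = s ∨ t = ρ • s := by
  classical
  have hne : ρ • s ≠ s := h.rho_smul_ne s
  have huniv : (Finset.univ : Finset (E i)) = {s, ρ • s} :=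
    (Finset.eq_univ_of_card _ (by rw [Finset.card_pair hne.symm, hc])).symm
  have ht : t ∈ ({s, ρ • s} : Finset (E i)) := huniv ▸ Finset.mem_univ t
  simpa [Finset.mem_insert, Finset.mem_singleton] using ht

/-- A two-element slot is nonempty. [cite: MoonenZarhin1999LowDim, Cor. (3.9)] -/
theorem nonempty_of_card_eq_two {i : I} (hc : Fintype.card (E i) = 2) : Nonempty (E i) := Fintype.card_pos_iff.1 (by omega)

/-- Some element of a two-element slot lies in the type. [cite: Kubota1965, §2 (p. 115)] -/
theorem exists_mem {i : I} (h : IsCMTypeWith ρ (Φ i)) (hc : Fintype.card (E i) = 2) : ∃ s : E i, s ∈ Φ i := by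
  obtain ⟨t⟩ := nonempty_of_card_eq_two hc
  by_cases ht : t ∈ Φ i
  exacts [⟨t, ht⟩, ⟨ρ • t, (h.rho_smul_mem_iff t).2 ht⟩]

/-- **Dichotomy**: on a two-element slot every `g ∈ G` either acts trivially or acts as `ρ` (`g` commutes with `ρ`).
[cite: MoonenZarhin1999LowDim, Cor. (3.9) (proof, Imai)] -/
theorem forall_smul_eq_or_forall_smul_eq_rho_smul {i : I} (h : IsCMTypeWith ρ (Φ i)) (hc : Fintype.card (E i) = 2)
    (g : G) : (∀ s : E i, g • s = s) ∨ ∀ s : E i, g • s = ρ • s := by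
  refine (em (∀ s : E i, g • s = s)).imp id fun hfix s => ?_
  obtain ⟨s₀, hs₀⟩ := not_forall.1 hfix
  have hg₀ : g • s₀ = ρ • s₀ := (eq_or_eq_rho_smul h hc s₀ (g • s₀)).resolve_left hs₀
  rcases eq_or_eq_rho_smul h hc s₀ s with rfl | rfl
  · exact hg₀
  · rw [h.comm g s₀, hg₀]

variable [∀ i, DecidableEq (E i)]

variable (G E) in
/-- **The sign character of the slot `i`**: `χ_i(g) = sgn(g|_{E_i}) ∈ {±1} ⊆ ℚ` — for `E_i = Hom(K_i, ℂ)`, `K_i` imaginary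
quadratic, the quadratic character of `Aut(ℂ)` (through `Gal(K_i/ℚ)`) cut out by `K_i`. [cite: MoonenZarhin1999LowDim, Cor. (3.9)] -/
def slotSign (i : I) : G →* ℚ :=
  (Int.castRingHom ℚ).toMonoidHom.comp <|
    (Units.coeHom ℤ).comp <| Equiv.Perm.sign.comp (MulAction.toPermHom G (E i))

/-- Unfolding of `slotSign`. [cite: MoonenZarhin1999LowDim, Cor. (3.9)] -/
theorem slotSign_apply (i : I) (g : G) :
    slotSign G E i g = ((Equiv.Perm.sign (MulAction.toPerm g : Equiv.Perm (E i)) : ℤˣ) : ℤ) := rfl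

/-- `χ_i(g) = 1` when `g` fixes the slot. [cite: MoonenZarhin1999LowDim, Cor. (3.9)] -/
theorem slotSign_of_forall_smul_eq {i : I} {g : G} (hg : ∀ s : E i, g • s = s) : slotSign G E i g = 1 := by
  have hperm : (MulAction.toPerm g : Equiv.Perm (E i)) = 1 := by
    ext s
    rw [MulAction.toPerm_apply, hg s, Equiv.Perm.coe_one, id]
  rw [slotSign_apply, hperm, Equiv.Perm.sign_one, Units.val_one, Int.cast_one]

/-- `χ_i(g) = -1` when `g` acts on the slot as `ρ` (a transposition). [cite: MoonenZarhin1999LowDim, Cor. (3.9)] -/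
theorem slotSign_of_forall_smul_eq_rho_smul {i : I} (h : IsCMTypeWith ρ (Φ i)) (hc : Fintype.card (E i) = 2) {g : G}
    (hg : ∀ s : E i, g • s = ρ • s) : slotSign G E i g = -1 := by
  obtain ⟨s₀⟩ := nonempty_of_card_eq_two hc
  have hperm : (MulAction.toPerm g : Equiv.Perm (E i)) = Equiv.swap s₀ (ρ • s₀) := by
    ext s
    rw [MulAction.toPerm_apply, hg s]
    rcases eq_or_eq_rho_smul h hc s₀ s with rfl | rfl
    · rw [Equiv.swap_apply_left]
    · rw [Equiv.swap_apply_right, h.invol]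
  rw [slotSign_apply, hperm, Equiv.Perm.sign_swap (h.rho_smul_ne s₀).symm, Units.val_neg, Units.val_one,
    Int.cast_neg, Int.cast_one]

/-- `g` fixes the slot `i` iff `χ_i(g) = 1`. [cite: MoonenZarhin1999LowDim, Cor. (3.9)] -/
theorem forall_smul_eq_iff_slotSign_eq_one {i : I} (h : IsCMTypeWith ρ (Φ i)) (hc : Fintype.card (E i) = 2) (g : G) :
    (∀ s : E i, g • s = s) ↔ slotSign G E i g = 1 := by
  refine ⟨slotSign_of_forall_smul_eq, fun h1 => ?_⟩
  rcases forall_smul_eq_or_forall_smul_eq_rho_smul h hc g with hg | hg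
  · exact hg
  · rw [slotSign_of_forall_smul_eq_rho_smul h hc hg] at h1; norm_num at h1

/-- `u_g(Φ_i)(s) = χ_i(g) · u_1(Φ_i)(s)` on a two-element slot. [cite: MoonenZarhin1999LowDim, Cor. (3.9) (proof)] -/
theorem antiVec_eq_slotSign_mul {i : I} (h : IsCMTypeWith ρ (Φ i)) (hc : Fintype.card (E i) = 2) (g : G) (s : E i) :
    antiVec (Φ i) g s = slotSign G E i g * antiVec (Φ i) (1 : G) s := by
  rcases forall_smul_eq_or_forall_smul_eq_rho_smul h hc g with hg | hg
  · rw [slotSign_of_forall_smul_eq hg, one_mul, antiVec_eq_of_forall_smul_eq hg]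
  · rw [slotSign_of_forall_smul_eq_rho_smul h hc hg, antiVec_eq_neg_of_forall_smul_eq_rho_smul h hg]; ring

/-- **`u_g(Σ) = Σ_i χ_i(g) · ext_i(u_1(Φ_i))`**: the `±1`-vector of a translate of the family type is the sign-weighted
sum of the members' vectors. [cite: MoonenZarhin1999LowDim, Cor. (3.9) (proof)] -/
theorem antiVec_sigmaType_eq_weightLift (h : ∀ i, IsCMTypeWith ρ (Φ i)) (hc : ∀ i, Fintype.card (E i) = 2) (g : G) :
    antiVec (sigmaType Φ) g = weightLift G Φ fun j => slotSign G E j g := by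
  funext x
  obtain ⟨j, s⟩ := x
  rw [antiVec_sigmaType, weightLift_apply]
  exact antiVec_eq_slotSign_mul (h j) (hc j) g s

/-- **Kubota separation of `Σ` makes the sign characters pairwise distinct** (for `(i, s_i), (j, s_j) ∈ Σ`, `i ≠ j`, a
`g` with `g s_i ∈ Φ_i ↮ g s_j ∈ Φ_j` fixes exactly one of the two slots). [cite: Kubota1965, §2 (p. 115)] -/
theorem slotSign_injective_of_separating (h : ∀ i, IsCMTypeWith ρ (Φ i)) (hc : ∀ i, Fintype.card (E i) = 2)
    (hsep : ∀ x y : Σ i, E i, (∀ g : G, g • x ∈ sigmaType Φ ↔ g • y ∈ sigmaType Φ) → x = y) :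
    Function.Injective (slotSign G E) := by
  intro i j hij
  by_contra hne
  obtain ⟨si, hsi⟩ := exists_mem (h i) (hc i)
  obtain ⟨sj, hsj⟩ := exists_mem (h j) (hc j)
  have key := hsep ⟨i, si⟩ ⟨j, sj⟩ fun g => by
    change g • si ∈ Φ i ↔ g • sj ∈ Φ j
    rcases forall_smul_eq_or_forall_smul_eq_rho_smul (h i) (hc i) g with hgi | hgi
    · have hgj : ∀ s : E j, g • s = s := by
        rw [forall_smul_eq_iff_slotSign_eq_one (h j) (hc j), ← hij]
        exact slotSign_of_forall_smul_eq hgi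
      rw [hgi si, hgj sj]
      exact ⟨fun _ => hsj, fun _ => hsi⟩
    · have hgj : ∀ s : E j, g • s = ρ • s := by
        rcases forall_smul_eq_or_forall_smul_eq_rho_smul (h j) (hc j) g with hgj | hgj
        · have h1 : slotSign G E i g = 1 := by rw [hij]; exact slotSign_of_forall_smul_eq hgj
          rw [slotSign_of_forall_smul_eq_rho_smul (h i) (hc i) hgi] at h1; norm_num at h1
        · exact hgj
      rw [hgi si, hgj sj, (h i).rho_smul_mem_iff, (h j).rho_smul_mem_iff]
      exact ⟨fun hn => (hn hsi).elim, fun hn => (hn hsj).elim⟩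
  exact hne (congrArg Sigma.fst key)

/-- The sign characters of a separating family are linearly independent functions `G → ℚ` (Dedekind–Artin).
[cite: MoonenZarhin1999LowDim, Cor. (3.9) (proof, Imai)] -/
theorem linearIndependent_slotSign (hinj : Function.Injective (slotSign G E)) :
    LinearIndependent ℚ fun i => (slotSign G E i : G → ℚ) :=
  (linearIndependent_monoidHom G ℚ).comp (slotSign G E) hinj

/-- **Each `ext_i(u_1(Φ_i))` lies in `U(Σ)`** when the sign characters are pairwise distinct: the sign vectors
`(χ_i(g))_i`, `g ∈ G`, span `ℚ^I` (a functional killing them all is a vanishing linear combination of distinct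
characters), and the weight lift maps the sign vector of `g` to `u_g(Σ)`. [cite: MoonenZarhin1999LowDim, Cor. (3.9) (proof, Imai)] -/
theorem slotExt_antiVec_one_mem_antiSpan [Fintype I] [DecidableEq I] (h : ∀ i, IsCMTypeWith ρ (Φ i))
    (hc : ∀ i, Fintype.card (E i) = 2) (hinj : Function.Injective (slotSign G E)) (i : I) :
    slotExt i (antiVec (Φ i) (1 : G)) ∈ antiSpan G (sigmaType Φ) := by
  have hx : (fun k => if i = k then (1 : ℚ) else 0) ∈
      Submodule.span ℚ (Set.range fun g : G => fun j => slotSign G E j g) := by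
    by_contra hx
    obtain ⟨f, hf, hfV⟩ := Submodule.exists_dual_map_eq_bot_of_notMem hx inferInstance
    have hzero : ∀ g : G, f (fun j => slotSign G E j g) = 0 := fun g => by
      have hm : f (fun j => slotSign G E j g) ∈
          (Submodule.span ℚ (Set.range fun g : G => fun j => slotSign G E j g)).map f :=
        Submodule.mem_map_of_mem (Submodule.subset_span ⟨g, rfl⟩)
      rwa [hfV, Submodule.mem_bot] at hm
    have hsum : ∑ j, (f fun k => if j = k then 1 else 0) • (slotSign G E j : G → ℚ) = 0 := by
      funext g
      have hg := hzero g
      rw [LinearMap.pi_apply_eq_sum_univ f] at hg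
      rw [Finset.sum_apply, Pi.zero_apply]
      calc ∑ j, ((f fun k => if j = k then 1 else 0) • (slotSign G E j : G → ℚ)) g
          = ∑ j, slotSign G E j g • f fun k => if j = k then 1 else 0 :=
            Finset.sum_congr rfl fun j _ => by rw [Pi.smul_apply, smul_eq_mul, smul_eq_mul, mul_comm]
        _ = 0 := hg
    exact hf ((Fintype.linearIndependent_iff.1 (linearIndependent_slotSign hinj)) _ hsum i)
  have hmap : (Submodule.span ℚ (Set.range fun g : G => fun j => slotSign G E j g)).map (weightLift G Φ) ≤
      antiSpan G (sigmaType Φ) := by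
    rw [Submodule.map_span, Submodule.span_le]
    rintro _ ⟨_, ⟨g, rfl⟩, rfl⟩
    change weightLift G Φ (fun j => slotSign G E j g) ∈ (antiSpan G (sigmaType Φ) : Set ((Σ i, E i) → ℚ))
    rw [← antiVec_sigmaType_eq_weightLift h hc g]
    exact Submodule.subset_span ⟨g, rfl⟩
  rw [← weightLift_single (G := G) (Φ := Φ) i]
  exact hmap (Submodule.mem_map_of_mem hx)

/-- **`|I| ≤ dim U(Σ)`** for a family of CM types on two-element slots with pairwise distinct sign characters (the
`ext_i(u_1(Φ_i))`, `i ∈ I`, are linearly independent members of `U(Σ)`). [cite: MoonenZarhin1999LowDim, Cor. (3.9)] -/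
theorem card_le_finrank_antiSpan_sigmaType [Fintype I] (h : ∀ i, IsCMTypeWith ρ (Φ i))
    (hc : ∀ i, Fintype.card (E i) = 2) (hinj : Function.Injective (slotSign G E)) :
    Fintype.card I ≤ Module.finrank ℚ (antiSpan G (sigmaType Φ)) := by
  classical
  have hli : LinearIndependent ℚ fun i => slotExt i (antiVec (Φ i) (1 : G)) := by
    rw [Fintype.linearIndependent_iff]
    intro c hc0 i
    obtain ⟨s⟩ := nonempty_of_card_eq_two (hc i)
    have hx := congrFun hc0 ⟨i, s⟩
    rw [Finset.sum_apply, Finset.sum_eq_single i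
        (fun j _ hji => by rw [Pi.smul_apply, slotExt_apply_of_ne (fun hij => hji hij.symm), smul_zero])
        (fun hi => (hi (Finset.mem_univ i)).elim), Pi.smul_apply, slotExt_apply_same, smul_eq_mul,
      Pi.zero_apply] at hx
    calc c i = c i * (antiVec (Φ i) (1 : G) s * antiVec (Φ i) (1 : G) s) := by rw [antiVec_one_mul_self, mul_one]
      _ = 0 := by rw [← mul_assoc, hx, zero_mul]
  have hle : Submodule.span ℚ (Set.range fun i => slotExt i (antiVec (Φ i) (1 : G))) ≤ antiSpan G (sigmaType Φ) := by
    rw [Submodule.span_le]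
    rintro _ ⟨i, rfl⟩
    exact slotExt_antiVec_one_mem_antiSpan h hc hinj i
  exact (finrank_span_eq_card hli).symm.trans_le (Submodule.finrank_mono hle)

/-- **`rank(Σ) = |⊔_i E_i|/2 + 1` for a family of CM types on two-element slots with pairwise distinct sign characters.**
[cite: MoonenZarhin1999LowDim, Cor. (3.9)] [cite: Deligne1982HodgeCycles, I Ex. 3.7 (c) (p. 26)] -/
theorem typeRank_sigmaType_eq_of_slotSign_injective [Fintype I] [Nonempty I] (h : ∀ i, IsCMTypeWith ρ (Φ i))
    (hc : ∀ i, Fintype.card (E i) = 2) (hinj : Function.Injective (slotSign G E)) :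
    typeRank G (sigmaType Φ) = Fintype.card (Σ i, E i) / 2 + 1 := by
  classical
  obtain ⟨i₀⟩ := ‹Nonempty I›
  obtain ⟨s₀⟩ := nonempty_of_card_eq_two (hc i₀)
  haveI : Nonempty (Σ i, E i) := ⟨⟨i₀, s₀⟩⟩
  have hS : IsCMTypeWith ρ (sigmaType Φ) := IsCMTypeWith.sigmaType h
  refine le_antisymm hS.typeRank_le ?_
  rw [hS.typeRank_eq_finrank_antiSpan_add_one]
  have hcardS : Fintype.card (Σ i, E i) = 2 * Fintype.card I := by
    rw [Fintype.card_sigma, Finset.sum_congr rfl fun i _ => hc i, Finset.sum_const, Finset.card_univ, smul_eq_mul, mul_comm]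
  have := card_le_finrank_antiSpan_sigmaType h hc hinj
  rw [hcardS, Nat.mul_div_cancel_left _ two_pos]; omega

/-- **A Kubota-separating family of CM types on two-element slots is nondegenerate: `rank(Σ) = |⊔_i E_i|/2 + 1`** —
`Hg(∏ E_i) = ∏ Hg(E_i)` for pairwise non-isogenous CM elliptic curves (Imai; Moonen–Zarhin Cor. (3.9)) in Deligne's rank
form `rank Y(MT(∏ E_i)) = |I| + 1`. [cite: MoonenZarhin1999LowDim, Cor. (3.9)] [cite: Deligne1982HodgeCycles, I Ex. 3.7 (c) (p. 26)] -/
theorem typeRank_sigmaType_eq_of_separating [Fintype I] [Nonempty I] (h : ∀ i, IsCMTypeWith ρ (Φ i))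
    (hc : ∀ i, Fintype.card (E i) = 2)
    (hsep : ∀ x y : Σ i, E i, (∀ g : G, g • x ∈ sigmaType Φ ↔ g • y ∈ sigmaType Φ) → x = y) :
    typeRank G (sigmaType Φ) = Fintype.card (Σ i, E i) / 2 + 1 :=
  typeRank_sigmaType_eq_of_slotSign_injective h hc (slotSign_injective_of_separating h hc hsep)

end TwoSlot

/-! ### Imaginary quadratic fields: separating families are nondegenerate -/

section Rank

variable {I : Type} {K : I → Type} [∀ i, Field (K i)] [∀ i, NumberField (K i)] [∀ i, IsCMField (K i)] [Fintype I]
  [Nonempty I]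

/-- **A separating family of CM types of imaginary quadratic fields is nondegenerate** (`cmFamilyRank Φ = |I| + 1`:
`rank Y(MT(∏_i E_i)) = Σ_i dim E_i + 1` for pairwise non-isogenous CM elliptic curves — Imai's theorem, Moonen–Zarhin
Cor. (3.9) «`Hg(X) = Hg(X₁) × ⋯ × Hg(X_n)`», in Deligne's rank form; no independence hypothesis on the fields).
[cite: MoonenZarhin1999LowDim, Cor. (3.9)] [cite: Deligne1982HodgeCycles, I Ex. 3.7 (c) (p. 26)] -/
theorem isNondegenerateFamily_of_finrank_eq_two (hK : ∀ i, Module.finrank ℚ (K i) = 2) {Φ : ∀ i, CMType (K i)}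
    (hsep : CMAlgebra.IsSeparatingFamily Φ) : CMAlgebra.IsNondegenerateFamily Φ := by
  classical
  rw [CMAlgebra.isNondegenerateFamily_iff]
  have hc : ∀ i, Fintype.card (K i →+* ℂ) = 2 := fun i => by rw [Embeddings.card, hK i]
  have hcardS : Fintype.card ((i : I) × (K i →+* ℂ)) = ∑ i, Module.finrank ℚ (K i) := by
    rw [Fintype.card_sigma]
    exact Finset.sum_congr rfl fun i _ => Embeddings.card (K i) ℂ
  rw [← hcardS]
  exact TwoSlot.typeRank_sigmaType_eq_of_separating (G := ℂ ≃+* ℂ) (Φ := fun i => (Φ i).1)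
    (fun i => isCMTypeWith_conj (Φ i)) hc ((CMAlgebra.isSeparatingFamily_iff_smul Φ).1 hsep)

end Rank

end Literature.AlgebraicGeometry.ComplexMultiplication

end
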